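/-
Copyright: the b2b-balaban T⁴-continuum CRUX team, row NE7b OWNER lineage `t4-ne7b-p1` (gen 135). Project licence.
-/
import Summits.QuantumFields.BalabanUV.T4Continuum.Spine.NE7b.SupGradientRegulator
import Summits.QuantumFields.BalabanUV.T4Continuum.Spine.NE7b.CovarianceKernelFloor

/-!
# LARGE FIELDS ON FINE CELLS ARE PAID WITH LOCAL MARGINS — (α3)'s GAUSSIAN HEART: (288)'s regulator cost `∫e^{½κΣ_{x∈U}ω_x²}dN(0,Γ) ≤ A^{#U}`
# needs the GLOBAL subcriticality `κ·γ_op(Γ) ≤ θ`; along the scales `γ_op(Γ_j)` grows (the field shells are coherent over their big cells, (374))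
# while the small-field conditions of a multi-scale analysis live on FINE cells `U` (a finest cell; a sparse union of finest cells, one per big
# cell).  Reading the fine-cell regulator as the field regulator of the RESTRICTED Gaussian `ω|_U ~ N(0, Γ|_U)` ((375) with `D` = the coordinate
# restriction) replaces the global letter by the LOCAL one:
#   (local cost)   `∫ e^{½κΣ_{x∈U}ω_x²} dN(0,Γ) ≤ A^{#U}`  and  (local tails) `P(t ≤ Σ_{x∈U}ω_x²) ≤ e^{−κt∕2}A^{#U}`  under  `κ·γ_op(Γ|_U) ≤ θ`,
#   (local letter) `γ_op(Γ|_U) ≤ max_{x∈U}Σ_{y∈U}|Γ(x,y)|` (Schur's test on the block — for a sparse union of finest cells of a finite-range ∕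
#                  decaying `Γ_j` this is `O(#finest cell × sup|Γ_j|)`, NOT `γ_op(Γ_j)`),
#   (two rates)    `∫ e^{½κ₁Σ_Pω² + ½κ₂Σ_Uω²} dN(0,Γ) ≤ ½(A₁^{#P} + A₂^{#U})` by AM–GM, with the SMALL rate `κ₁` subcritical GLOBALLY
#                  (`2κ₁γ_op(Γ) ≤ θ`) and the LARGE rate `κ₂` subcritical LOCALLY (`2κ₂γ_op(Γ|_U) ≤ θ`),
#   (union bound)  `∫ e^{½κ₁Σ_Pω²}·1{∃c∈𝒞: r² < Σ_cω²} dN(0,Γ) ≤ e^{−½κ₂r²}·Σ_{c∈𝒞}½(A₁^{#P} + A_{2,c}^{#c})`: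
# a stability growth at the small rate on the BIG cell times a large-field event on SOME FINE cell is paid by the fine cell's LOCAL margin —
# the per-fine-cell small-field bookkeeping that SCOPING-d7 (α3) asks for, with honest letters (row NE7b, node U5c; (375)∕(288) + the leaf's
# Schur test `CovarianceKernelFloor.dotProduct_mulVec_le_of_rowSum_colSum` BY NAME; [folklore])

Cell `pub-balaban`, sub-cell `t4`, spine estimate NE7b (`T4WeightBudget.RelWeightBound`; the cell's OWN estimate — NOT PRINTED in
[Bałaban 1983–89], NOT PROVED).  Crux-route work under `Spine/NE7b/` by the row OWNER (`t4-ne7b-p1` gen 135, file (378)) under FREEZE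
(0)'s crux-prover clause, on this gen's SCOPING-d7 DECISION (1) in its honest form («per-FINE-cell small-field conditions, their complement paid at
the next integration with a LOCAL rate»); NOTHING of Bałaban's is named as a Lean object, valued or asserted; no `T4Continuum/Support` leaf typed;
no `def`, no notation (the restriction matrix is written out as `Matrix.of fun e x => if ↑e = x then 1 else 0`); zero `sorry`.  Imports (BY NAME):
the OWNER's (375) `…SupGradientRegulator` (`integral_exp_half_gradSq_on_le`, `measureReal_gradSq_ge_le`, `integrable_gradRegulator`,
`gradCov_posSemidef`; through it (288)∕(289)), the leaf's `…CovarianceKernelFloor` (`dotProduct_mulVec_le_of_rowSum_colSum`); Mathlib's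
`Matrix.PosSemidef.of_dotProduct_mulVec_nonneg`, `Matrix.IsHermitian.submatrix`, `Finset.sum_coe_sort`, `Finset.sum_ite_eq`.

WHAT IS PROVED ([folklore]; `R_U := (e, x) ↦ 1{↑e = x}` the restriction to `U ⊆ ι`, `Γ|_U := Γ.submatrix val val`):
* §1 THE RESTRICTION AS A PUSHFORWARD: `restrict_mulVec` (`(R_Uω)_e = ω_e`), `restrict_conj` (`R_UΓR_Uᵀ = Γ|_U`), `sum_restrict_sq`
  (`Σ_{e:U}(R_Uω)_e² = Σ_{x∈U}ω_x²`);
* §2 THE LOCAL LETTER: **`local_opNorm_of_rowSum`** (`Γ ⪰ 0`, `Σ_{y∈U}|Γ(x,y)| ≤ r` for `x ∈ U` ⟹ `(r·1 − Γ|_U) ⪰ 0`);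
* §3 LOCAL COST AND TAILS: **`integral_exp_half_sq_on_le_local`** (`∫e^{½κΣ_Uω²}dN(0,Γ) ≤ A^{#U}` under `(γ_U·1 − Γ|_U) ⪰ 0`, `κγ_U ≤ θ`, diagonal
  `≤ γ` on `U`), `integrable_exp_half_sq_on_local`, **`measureReal_sum_sq_ge_le_local`**;
* §4 TWO RATES BY AM–GM: `exp_add_le_half_add` (`e^{a+b} ≤ ½(e^{2a} + e^{2b})`), **`integral_twoRate_le`** (displayed);
* §5 THE UNION BOUND: `indicator_exists_le_sum` (pointwise), **`integral_stability_largeFine_le`** (displayed); §6 toy.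

HONEST (what this is NOT).  Gaussian inputs with honest (local) letters; the Schur letter `Σ_{y∈U}|Γ(x,y)| ≤ r` for the lineage's shells is the
successor's (the decay columns (173)–(189)∕(284) give entries; a sparse-union row sum is `≤ (3^d+1)·v₀·sup|Γ_j|` by finite range); the
fine-cell two-letter format built on these inputs (the per-fine-cell version of (376)∕(377), products over big cells = sums over choice functions of
fine cells, one `integral_twoRate_le`-type cost per choice) is NOT typed here; (α4) contraction untouched; scalar skeleton ((A3), NC-NE7b-α
UNRULED); nothing of Bałaban's asserted (his small-field conditions are per bond∕plaquette of the current lattice — exactly «per fine cell»).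
BY-NAME EFFECT ON THE WALL: NONE.  NE7b NOT PRINTED ∕ NOT PROVED; spine PROVED 0∕9; rung (B)+1 — the programme's measures remain FINITE-torus
statements; NOT the mass gap, NOT Clay.  HONEST DEPENDENCY: continuum YM on T⁴ ⇐ BetaPertH ∧ nine spine estimates (0∕9 proved); BetaPertH ⇐
(D1) ∧ (D4) ∧ CAP+tail; G-an2-4 gates asym, D1 and NE2∕3∕4.
-/

set_option autoImplicit false

noncomputable section

namespace Summit.QuantumFields.BalabanUV.T4Continuum.NE7b.SupFineCellRegulator

open MeasureTheory ProbabilityTheory Matrix Real Finset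
open scoped BigOperators
open SupGradientRegulator (integral_exp_half_gradSq_on_le measureReal_gradSq_ge_le integrable_gradRegulator gradCov_posSemidef)
open SupRegulatedActivityBound (one_le_regulatorCost)
open CovarianceKernelFloor (dotProduct_mulVec_le_of_rowSum_colSum)

variable {ι : Type} [Fintype ι] [DecidableEq ι]

/-! ## §1. The restriction to a cell set as a matrix pushforward -/

/-- `(R_Uω)_e = ω_e`. [folklore] -/
theorem restrict_mulVec (U : Finset ι) (v : ι → ℝ) (e : U) :
    ((Matrix.of fun (e : U) (x : ι) => if (e : ι) = x then (1 : ℝ) else 0) *ᵥ v) e = v e := by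
  simp [Matrix.mulVec, dotProduct, Finset.sum_ite_eq]

/-- `R_U Γ R_Uᵀ = Γ|_U`. [folklore] -/
theorem restrict_conj (U : Finset ι) (Γ : Matrix ι ι ℝ) :
    (Matrix.of fun (e : U) (x : ι) => if (e : ι) = x then (1 : ℝ) else 0) * Γ *
        (Matrix.of fun (e : U) (x : ι) => if (e : ι) = x then (1 : ℝ) else 0)ᵀ =
      Γ.submatrix (fun e : U => (e : ι)) (fun e : U => (e : ι)) := by
  ext e e'
  simp [Matrix.mul_apply, Matrix.transpose_apply, Finset.sum_ite_eq]

/-- `Σ_{e:U}(R_Uω)_e² = Σ_{x∈U}ω_x²`. [folklore] -/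
theorem sum_restrict_sq (U : Finset ι) (v : ι → ℝ) :
    ∑ e ∈ (Finset.univ : Finset U), ((Matrix.of fun (e : U) (x : ι) => if (e : ι) = x then (1 : ℝ) else 0) *ᵥ v) e ^ 2 =
      ∑ x ∈ U, v x ^ 2 := by
  simp only [restrict_mulVec]
  exact Finset.sum_coe_sort U (fun x => v x ^ 2)

/-! ## §2. The local letter: the block's operator norm from its row sums -/

omit [Fintype ι] in
/-- **THE LOCAL OPERATOR-NORM LETTER FROM ROW SUMS** (Schur's test on the block): `Γ ⪰ 0` and `Σ_{y∈U}|Γ(x,y)| ≤ r` for every `x ∈ U` ⟹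
`r·1 − Γ|_U ⪰ 0`. [folklore] -/
theorem local_opNorm_of_rowSum {Γ : Matrix ι ι ℝ} (hΓ : Γ.PosSemidef) (U : Finset ι) {r : ℝ}
    (hrow : ∀ x ∈ U, ∑ y ∈ U, |Γ x y| ≤ r) :
    (r • (1 : Matrix U U ℝ) - Γ.submatrix (fun e : U => (e : ι)) (fun e : U => (e : ι))).PosSemidef := by
  set C : Matrix U U ℝ := Γ.submatrix (fun e : U => (e : ι)) (fun e : U => (e : ι)) with hC
  have hCh : C.IsHermitian := hΓ.isHermitian.submatrix _
  have hsymm : ∀ e e' : U, C e e' = C e' e := fun e e' => by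
    have h := congrFun (congrFun hCh e') e
    simpa [Matrix.conjTranspose_apply] using h
  -- Schur's test with the dominating matrix `N = |C|`, whose row sums (= column sums by symmetry) are `≤ r`
  have hrowU : ∀ e : U, ∑ e' : U, |C e e'| ≤ r := fun e => by
    have h := hrow e e.2
    rw [← Finset.sum_coe_sort U (fun y => |Γ e y|)] at h
    exact h
  have hcolU : ∀ e' : U, ∑ e : U, |C e e'| ≤ r := fun e' => by
    have h := hrowU e'
    calc ∑ e : U, |C e e'| = ∑ e : U, |C e' e| := Finset.sum_congr rfl fun e _ => by rw [hsymm]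
      _ ≤ r := h
  refine Matrix.PosSemidef.of_dotProduct_mulVec_nonneg ?_ fun x => ?_
  · have h1 : (r • (1 : Matrix U U ℝ)).IsHermitian := by
      rw [Matrix.IsHermitian, Matrix.conjTranspose_smul, Matrix.conjTranspose_one, star_trivial]
    exact h1.sub hCh
  · have hschur := dotProduct_mulVec_le_of_rowSum_colSum C (fun e e' => |C e e'|) (fun _ _ => le_rfl) hrowU hcolU x
    have hstar : (star x : U → ℝ) = x := star_trivial x
    rw [hstar, sub_mulVec, dotProduct_sub, smul_mulVec, one_mulVec, dotProduct_smul, smul_eq_mul]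
    linarith

/-! ## §3. Local cost and local tails -/

/-- **(local cost) THE FINE-CELL REGULATOR COSTS `A^{#U}` UNDER THE LOCAL MARGIN**: `Γ ⪰ 0`, `γ_U·1 − Γ|_U ⪰ 0`, `Γ(x,x) ≤ γ` on `U`, `0 ≤ κ`,
`0 < θ < 1`, `κγ_U ≤ θ` ⟹ `∫ e^{½κΣ_{x∈U}ω_x²} dN(0,Γ) ≤ ((1−θ)^{−κγ∕(2θ)})^{#U}`. [folklore] -/
theorem integral_exp_half_sq_on_le_local {Γ : Matrix ι ι ℝ} {γU γ κ θ : ℝ} (hΓ : Γ.PosSemidef) (U : Finset ι)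
    (hU : (γU • (1 : Matrix U U ℝ) - Γ.submatrix (fun e : U => (e : ι)) (fun e : U => (e : ι))).PosSemidef)
    (hdiag : ∀ x ∈ U, Γ x x ≤ γ) (hκ : 0 ≤ κ) (hθ0 : 0 < θ) (hθ1 : θ < 1) (hκθ : κ * γU ≤ θ) :
    ∫ ω, exp (κ * (∑ x ∈ U, ω x ^ 2) / 2) ∂(multivariateGaussian (0 : EuclideanSpace ℝ ι) Γ) ≤
      ((1 - θ) ^ (-(κ * γ / (2 * θ)))) ^ U.card := by
  set D : Matrix U ι ℝ := Matrix.of fun (e : U) (x : ι) => if (e : ι) = x then (1 : ℝ) else 0 with hD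
  have hC : (γU • (1 : Matrix U U ℝ) - D * Γ * Dᵀ).PosSemidef := by rw [hD, restrict_conj]; exact hU
  have h := integral_exp_half_gradSq_on_le hΓ D hC hκ hθ0 hθ1 hκθ Finset.univ (γ := γ) (fun e _ => by
    rw [hD, restrict_conj]; exact hdiag e e.2)
  simp only [hD, sum_restrict_sq, Finset.card_univ, Fintype.card_coe] at h
  exact h

/-- Integrability of the fine-cell regulator under the local margin. [folklore] -/
theorem integrable_exp_half_sq_on_local {Γ : Matrix ι ι ℝ} {γU κ θ : ℝ} (hΓ : Γ.PosSemidef) (U : Finset ι)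
    (hU : (γU • (1 : Matrix U U ℝ) - Γ.submatrix (fun e : U => (e : ι)) (fun e : U => (e : ι))).PosSemidef)
    (hκ : 0 ≤ κ) (hθ1 : θ < 1) (hκθ : κ * γU ≤ θ) :
    Integrable (fun ω : EuclideanSpace ℝ ι => exp (κ * (∑ x ∈ U, ω x ^ 2) / 2)) (multivariateGaussian 0 Γ) := by
  set D : Matrix U ι ℝ := Matrix.of fun (e : U) (x : ι) => if (e : ι) = x then (1 : ℝ) else 0 with hD
  have hC : (γU • (1 : Matrix U U ℝ) - D * Γ * Dᵀ).PosSemidef := by rw [hD, restrict_conj]; exact hU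
  have h := integrable_gradRegulator hΓ D hC hκ hθ1 hκθ Finset.univ
  simp only [hD, sum_restrict_sq] at h
  exact h

/-- **(local tails) LARGE FIELDS ON A FINE CELL ARE RARE UNDER THE LOCAL MARGIN**: same hypotheses ⟹ for every `t`,
`P_{N(0,Γ)}(t ≤ Σ_{x∈U}ω_x²) ≤ e^{−κt∕2}·((1−θ)^{−κγ∕(2θ)})^{#U}`. [folklore] -/
theorem measureReal_sum_sq_ge_le_local {Γ : Matrix ι ι ℝ} {γU γ κ θ : ℝ} (hΓ : Γ.PosSemidef) (U : Finset ι)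
    (hU : (γU • (1 : Matrix U U ℝ) - Γ.submatrix (fun e : U => (e : ι)) (fun e : U => (e : ι))).PosSemidef)
    (hdiag : ∀ x ∈ U, Γ x x ≤ γ) (hκ : 0 ≤ κ) (hθ0 : 0 < θ) (hθ1 : θ < 1) (hκθ : κ * γU ≤ θ) (t : ℝ) :
    (multivariateGaussian (0 : EuclideanSpace ℝ ι) Γ).real {ω | t ≤ ∑ x ∈ U, ω x ^ 2} ≤
      exp (-(κ * t / 2)) * ((1 - θ) ^ (-(κ * γ / (2 * θ)))) ^ U.card := by
  set D : Matrix U ι ℝ := Matrix.of fun (e : U) (x : ι) => if (e : ι) = x then (1 : ℝ) else 0 with hD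
  have hC : (γU • (1 : Matrix U U ℝ) - D * Γ * Dᵀ).PosSemidef := by rw [hD, restrict_conj]; exact hU
  have h := measureReal_gradSq_ge_le hΓ D hC hκ hθ0 hθ1 hκθ Finset.univ (γ := γ) (fun e _ => by
    rw [hD, restrict_conj]; exact hdiag e e.2) t
  simp only [hD, sum_restrict_sq, Finset.card_univ, Fintype.card_coe] at h
  exact h

/-! ## §4. Two rates by AM–GM -/

omit [Fintype ι] [DecidableEq ι] in
/-- **AM–GM for two regulators**: `e^{a+b} ≤ ½(e^{2a} + e^{2b})`. [folklore] -/
theorem exp_add_le_half_add (a b : ℝ) : exp (a + b) ≤ (exp (2 * a) + exp (2 * b)) / 2 := by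
  have h1 : exp (2 * a) = exp a ^ 2 := by rw [← Real.exp_nat_mul]; norm_num
  have h2 : exp (2 * b) = exp b ^ 2 := by rw [← Real.exp_nat_mul]; norm_num
  rw [Real.exp_add, h1, h2]
  nlinarith [sq_nonneg (exp a - exp b)]

/-- **(two rates) THE SMALL RATE PAYS GLOBALLY, THE LARGE RATE LOCALLY**: `Γ ⪰ 0`, `Γ ⪯ γ_op·1`, `γ_U·1 − Γ|_U ⪰ 0`, diagonal `≤ γ`; rates
`0 ≤ κ₁, κ₂` with `2κ₁γ_op ≤ θ`, `2κ₂γ_U ≤ θ`, `0 < θ < 1` ⟹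
`∫ e^{½κ₁Σ_{x∈P}ω_x² + ½κ₂Σ_{x∈U}ω_x²} dN(0,Γ) ≤ ½(((1−θ)^{−2κ₁γ∕(2θ)})^{#P} + ((1−θ)^{−2κ₂γ∕(2θ)})^{#U})`. [folklore] -/
theorem integral_twoRate_le {Γ : Matrix ι ι ℝ} {γop γU γ κ₁ κ₂ θ : ℝ} (hΓ : Γ.PosSemidef)
    (hΓop : (γop • (1 : Matrix ι ι ℝ) - Γ).PosSemidef) (P U : Finset ι)
    (hU : (γU • (1 : Matrix U U ℝ) - Γ.submatrix (fun e : U => (e : ι)) (fun e : U => (e : ι))).PosSemidef)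
    (hdiag : ∀ x, Γ x x ≤ γ) (hκ₁ : 0 ≤ κ₁) (hκ₂ : 0 ≤ κ₂) (hθ0 : 0 < θ) (hθ1 : θ < 1)
    (h1 : 2 * κ₁ * γop ≤ θ) (h2 : 2 * κ₂ * γU ≤ θ) :
    ∫ ω, exp (κ₁ * (∑ x ∈ P, ω x ^ 2) / 2 + κ₂ * (∑ x ∈ U, ω x ^ 2) / 2) ∂(multivariateGaussian (0 : EuclideanSpace ℝ ι) Γ) ≤
      (((1 - θ) ^ (-(2 * κ₁ * γ / (2 * θ)))) ^ P.card + ((1 - θ) ^ (-(2 * κ₂ * γ / (2 * θ)))) ^ U.card) / 2 := by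
  set μ := multivariateGaussian (0 : EuclideanSpace ℝ ι) Γ with hμ
  have h2κ₁ : 0 ≤ 2 * κ₁ := by positivity
  have h2κ₂ : 0 ≤ 2 * κ₂ := by positivity
  have hintP := SupGaussianRegulator.integrable_exp_half_sq_on hΓ hΓop h2κ₁ hθ1 h1 P
  have hintU := integrable_exp_half_sq_on_local hΓ U hU h2κ₂ hθ1 h2
  have hP := SupGaussianRegulator.integral_exp_half_sq_on_le hΓ hΓop h2κ₁ hθ0 hθ1 h1 P fun i _ => hdiag i
  have hUc := integral_exp_half_sq_on_le_local hΓ U hU (fun x _ => hdiag x) h2κ₂ hθ0 hθ1 h2 (γ := γ)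
  calc ∫ ω, exp (κ₁ * (∑ x ∈ P, ω x ^ 2) / 2 + κ₂ * (∑ x ∈ U, ω x ^ 2) / 2) ∂μ
      ≤ ∫ ω, (exp (2 * κ₁ * (∑ x ∈ P, ω x ^ 2) / 2) + exp (2 * κ₂ * (∑ x ∈ U, ω x ^ 2) / 2)) / 2 ∂μ := by
        refine integral_mono_of_nonneg (ae_of_all _ fun _ => (exp_pos _).le) ((hintP.add hintU).div_const 2) (ae_of_all _ fun ω => ?_)
        have h := exp_add_le_half_add (κ₁ * (∑ x ∈ P, ω x ^ 2) / 2) (κ₂ * (∑ x ∈ U, ω x ^ 2) / 2)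
        have e1 : 2 * (κ₁ * (∑ x ∈ P, ω x ^ 2) / 2) = 2 * κ₁ * (∑ x ∈ P, ω x ^ 2) / 2 := by ring
        have e2 : 2 * (κ₂ * (∑ x ∈ U, ω x ^ 2) / 2) = 2 * κ₂ * (∑ x ∈ U, ω x ^ 2) / 2 := by ring
        rw [e1, e2] at h
        exact h
    _ = (∫ ω, exp (2 * κ₁ * (∑ x ∈ P, ω x ^ 2) / 2) ∂μ + ∫ ω, exp (2 * κ₂ * (∑ x ∈ U, ω x ^ 2) / 2) ∂μ) / 2 := by
        rw [integral_div, integral_add hintP hintU]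
    _ ≤ _ := by gcongr

/-! ## §5. The union bound: a stability growth on the big cell times a large field on some fine cell -/

omit [Fintype ι] [DecidableEq ι] in
/-- **POINTWISE UNION BOUND WITH CONVERSION**: `0 ≤ κ₂`, `G ≥ 0` ⟹
`G·1{∃c∈𝒞: r² < Q_c} ≤ e^{−½κ₂r²}·Σ_{c∈𝒞}G·e^{½κ₂Q_c}` (on the event pick the large cell `c`: `1 ≤ e^{½κ₂(Q_c − r²)}`; the other summands are `≥ 0`).
[folklore] -/
theorem indicator_exists_le_sum {W : Type*} (𝒞 : Finset W) (Q : W → ℝ) {G κ₂ r : ℝ} (hG : 0 ≤ G) (hκ₂ : 0 ≤ κ₂)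
    [Decidable (∃ c ∈ 𝒞, r ^ 2 < Q c)] :
    (if ∃ c ∈ 𝒞, r ^ 2 < Q c then G else 0) ≤ exp (-(κ₂ * r ^ 2 / 2)) * ∑ c ∈ 𝒞, G * exp (κ₂ * Q c / 2) := by
  have hsum0 : 0 ≤ exp (-(κ₂ * r ^ 2 / 2)) * ∑ c ∈ 𝒞, G * exp (κ₂ * Q c / 2) :=
    mul_nonneg (exp_pos _).le (sum_nonneg fun c _ => by positivity)
  split_ifs with h
  · obtain ⟨c, hc, hrc⟩ := h
    have hone : G ≤ exp (-(κ₂ * r ^ 2 / 2)) * (G * exp (κ₂ * Q c / 2)) := by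
      rw [← mul_assoc, mul_comm (exp _) G, mul_assoc, ← Real.exp_add]
      refine le_mul_of_one_le_right hG (one_le_exp ?_)
      have := mul_le_mul_of_nonneg_left hrc.le hκ₂
      linarith
    exact hone.trans (mul_le_mul_of_nonneg_left (single_le_sum (f := fun c => G * exp (κ₂ * Q c / 2))
      (fun c _ => by positivity) hc) (exp_pos _).le)
  · exact hsum0

/-- **(union bound) THE END — STABILITY GROWTH ON THE BIG CELL TIMES A LARGE FIELD ON SOME FINE CELL IS PAID BY THE FINE CELLS' LOCAL MARGINS**:
`Γ ⪰ 0`, `Γ ⪯ γ_op·1`, diagonal `≤ γ`; a finite family `𝒞` of fine cells, each with the local letter `γ_c·1 − Γ|_c ⪰ 0` and `2κ₂γ_c ≤ θ`;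
`2κ₁γ_op ≤ θ`; `0 ≤ κ₁, κ₂`, `0 < θ < 1` ⟹
`∫ e^{½κ₁Σ_{x∈P}ω_x²}·1{∃c∈𝒞: r² < Σ_{x∈c}ω_x²} dN(0,Γ) ≤ e^{−½κ₂r²}·Σ_{c∈𝒞}½(A₁^{#P} + A₂^{#c})`,
`A₁ = (1−θ)^{−2κ₁γ∕(2θ)}`, `A₂ = (1−θ)^{−2κ₂γ∕(2θ)}`. [folklore] -/
theorem integral_stability_largeFine_le {Γ : Matrix ι ι ℝ} {γop γ κ₁ κ₂ θ r : ℝ} (hΓ : Γ.PosSemidef)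
    (hΓop : (γop • (1 : Matrix ι ι ℝ) - Γ).PosSemidef) (hdiag : ∀ x, Γ x x ≤ γ) (P : Finset ι) (𝒞 : Finset (Finset ι))
    (γc : Finset ι → ℝ)
    (hloc : ∀ c ∈ 𝒞, ((γc c) • (1 : Matrix c c ℝ) - Γ.submatrix (fun e : c => (e : ι)) (fun e : c => (e : ι))).PosSemidef)
    (hκ₁ : 0 ≤ κ₁) (hκ₂ : 0 ≤ κ₂) (hθ0 : 0 < θ) (hθ1 : θ < 1) (h1 : 2 * κ₁ * γop ≤ θ) (h2 : ∀ c ∈ 𝒞, 2 * κ₂ * γc c ≤ θ) :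
    ∫ ω, (if ∃ c ∈ 𝒞, r ^ 2 < ∑ x ∈ c, ω x ^ 2 then exp (κ₁ * (∑ x ∈ P, ω x ^ 2) / 2) else 0)
        ∂(multivariateGaussian (0 : EuclideanSpace ℝ ι) Γ) ≤
      exp (-(κ₂ * r ^ 2 / 2)) * ∑ c ∈ 𝒞,
        (((1 - θ) ^ (-(2 * κ₁ * γ / (2 * θ)))) ^ P.card + ((1 - θ) ^ (-(2 * κ₂ * γ / (2 * θ)))) ^ c.card) / 2 := by
  set μ := multivariateGaussian (0 : EuclideanSpace ℝ ι) Γ with hμ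
  have h2κ₁ : 0 ≤ 2 * κ₁ := by positivity
  have h2κ₂ : 0 ≤ 2 * κ₂ := by positivity
  -- each summand `e^{½κ₁Q_P + ½κ₂Q_c}` is integrable (AM–GM domination by the two one-rate regulators) with the two-rate cost
  have hint : ∀ c ∈ 𝒞, Integrable (fun ω : EuclideanSpace ℝ ι =>
      exp (κ₁ * (∑ x ∈ P, ω x ^ 2) / 2) * exp (κ₂ * (∑ x ∈ c, ω x ^ 2) / 2)) μ := by
    intro c hc
    have hintP := SupGaussianRegulator.integrable_exp_half_sq_on hΓ hΓop h2κ₁ hθ1 h1 P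
    have hintU := integrable_exp_half_sq_on_local hΓ c (hloc c hc) h2κ₂ hθ1 (h2 c hc)
    refine Integrable.mono' ((hintP.add hintU).div_const 2) (by fun_prop) (ae_of_all _ fun ω => ?_)
    rw [Real.norm_of_nonneg (by positivity), ← Real.exp_add]
    have h := exp_add_le_half_add (κ₁ * (∑ x ∈ P, ω x ^ 2) / 2) (κ₂ * (∑ x ∈ c, ω x ^ 2) / 2)
    have e1 : 2 * (κ₁ * (∑ x ∈ P, ω x ^ 2) / 2) = 2 * κ₁ * (∑ x ∈ P, ω x ^ 2) / 2 := by ring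
    have e2 : 2 * (κ₂ * (∑ x ∈ c, ω x ^ 2) / 2) = 2 * κ₂ * (∑ x ∈ c, ω x ^ 2) / 2 := by ring
    rw [e1, e2] at h
    exact h
  have hsumint : Integrable (fun ω : EuclideanSpace ℝ ι => exp (-(κ₂ * r ^ 2 / 2)) *
      ∑ c ∈ 𝒞, exp (κ₁ * (∑ x ∈ P, ω x ^ 2) / 2) * exp (κ₂ * (∑ x ∈ c, ω x ^ 2) / 2)) μ :=
    (integrable_finsetSum 𝒞 hint).const_mul _
  calc ∫ ω, (if ∃ c ∈ 𝒞, r ^ 2 < ∑ x ∈ c, ω x ^ 2 then exp (κ₁ * (∑ x ∈ P, ω x ^ 2) / 2) else 0) ∂μ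
      ≤ ∫ ω, exp (-(κ₂ * r ^ 2 / 2)) * ∑ c ∈ 𝒞, exp (κ₁ * (∑ x ∈ P, ω x ^ 2) / 2) * exp (κ₂ * (∑ x ∈ c, ω x ^ 2) / 2) ∂μ := by
        refine integral_mono_of_nonneg (ae_of_all _ fun ω => ?_) hsumint (ae_of_all _ fun ω => ?_)
        · dsimp only
          split_ifs <;> positivity
        · exact indicator_exists_le_sum 𝒞 (fun c => ∑ x ∈ c, ω x ^ 2) (exp_pos _).le hκ₂
    _ = exp (-(κ₂ * r ^ 2 / 2)) * ∑ c ∈ 𝒞, ∫ ω, exp (κ₁ * (∑ x ∈ P, ω x ^ 2) / 2) * exp (κ₂ * (∑ x ∈ c, ω x ^ 2) / 2) ∂μ := by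
        rw [integral_const_mul, integral_finsetSum 𝒞 hint]
    _ ≤ exp (-(κ₂ * r ^ 2 / 2)) * ∑ c ∈ 𝒞,
        (((1 - θ) ^ (-(2 * κ₁ * γ / (2 * θ)))) ^ P.card + ((1 - θ) ^ (-(2 * κ₂ * γ / (2 * θ)))) ^ c.card) / 2 := by
        refine mul_le_mul_of_nonneg_left (sum_le_sum fun c hc => ?_) (exp_pos _).le
        have h := integral_twoRate_le hΓ hΓop P c (hloc c hc) hdiag hκ₁ hκ₂ hθ0 hθ1 h1 (h2 c hc) (γ := γ)
        refine le_trans (le_of_eq (integral_congr_ae (ae_of_all _ fun ω => ?_))) h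
        dsimp only
        rw [← Real.exp_add]

/-! ## §6. Toy -/

omit [Fintype ι] [DecidableEq ι] in
/-- Toy (§4): `e^{0+0} = 1 ≤ ½(1 + 1)`. -/
example : exp (0 + 0) ≤ (exp (2 * 0) + exp (2 * 0)) / 2 := exp_add_le_half_add 0 0

end Summit.QuantumFields.BalabanUV.T4Continuum.NE7b.SupFineCellRegulator
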